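import Mathlib.RingTheory.Spectrum.Prime.Topology
import Mathlib.RingTheory.Localization.AtPrime.Basic
import Mathlib.RingTheory.FiniteType
import Mathlib.RingTheory.Regular.RegularSequence
import Mathlib.RingTheory.KrullDimension.Basic
import HarnessLib

/-!
# Openness of the F-injective locus (Datta–Murayama 2024, Theorem B) — named fact

Topic: `Literature/AlgebraicGeometry/Resolution` (sibling of `Macaulayfication.lean`, whose inline
Cohen–Macaulay clause is reused verbatim, here at the localizations `R_P`). Source: R. Datta,
T. Murayama, *Permanence properties of F-injectivity*, Math. Res. Lett. **31** (2024), no. 4, 985–1027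
[DattaMurayama2024] = arXiv:1906.11399v4 (7 Aug 2023; locators below are pages/lines of that arXiv PDF,
read on the page by `res-lit-6`, campaign `res-hironaka`, director line 2026-08-26T18:08:56Z (A)(ii); the
publisher PDF is not held, so no journal page is quoted).

**Theorem B** (arXiv v4 p.3 l.37–39, restated and PROVED in §5.2, p.19 l.26–28 ff.): «Let R be a ring
essentially of finite type over a Noetherian local ring (A, 𝔪) of prime characteristic p > 0, and suppose
that A has Cohen–Macaulay and geometrically F-injective formal fibers. Then, the F-injective locus is open
in Spec(R).» — «The condition on formal fibers holds if A is excellent» (p.3 l.40); «We note that the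
hypotheses on the formal fibers of A are satisfied when A is excellent, or more generally, a G-ring» (p.19
l.29–30). Here a Noetherian local ring `(R, 𝔪)` is *F-injective* when the Frobenius actions
`H^i_𝔪(R) → H^i_𝔪(F_{R*}R)` are injective for all `i` (Def. 2.1, p.5 l.5–11), and the F-injective locus
of `R` is `{P ∈ Spec R | R_P is F-injective}`.

**Lemma 2.6** of the same paper (p.5 l.48–53, with the citations «[FW89, Rem. 1.9 and Prop. 2.2; Has10,
Lem. 4.4; QS17, Thm. 3.7 and Cor. 3.9]»): «Let (R, 𝔪) be a Cohen–Macaulay local ring of prime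
characteristic p > 0. Then, the following are equivalent: (i) The ring R is F-injective. (ii) Every ideal
generated by a system of parameters for R is Frobenius closed. (iii) There exists an ideal generated by a
system of parameters for R that is Frobenius closed.» — proved in print as Quy–Shimomoto, Adv. Math. 313
(2017), Cor. 3.9 [QuyShimomoto2017] («Let (R,𝔪,k) be a Cohen-Macaulay local ring of characteristic p>0.
Then the following are equivalent: Every parameter ideal of R is Frobenius closed. / There is a parameter
ideal of R that is Frobenius closed. / R is F-injective.», held text arXiv:1601.02524 chunk p0007
L33–38) and Fedder–Watanabe 1989, Rem. 1.9 [FedderWatanabe1989]. Frobenius closure: Def. 2.5, p.5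
l.35–45 «I^F := {x ∈ R | x^{p^e} ∈ I^{[p^e]} for some e > 0} … We say that I is Frobenius closed if
I = I^F» (the tree's `Literature.RingTheory.TightClosure.IsFrobeniusClosed`; inline form
`Literature.RingTheory.TightClosure.isFrobeniusClosed_iff`).

## What is typed, and in which generality (read before using the fact)

Mathlib has no local cohomology with Frobenius action, no Cohen–Macaulay predicate and no excellent
rings, so the fact is vendored as the COMPOSITE «Theorem B ∘ Lemma 2.6 (i)⇔(ii)», in the special case and
the vocabulary of its consumer (route `FrobeniusLadder` of summit `ResolutionOfSingularities`, crux
`FInjectiveMacaulayfication`: the summit-side reduction `…FiLocusOpenOfAffine.fiLocusOpen_of_ringLevel`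
takes exactly the universe-`0` instance of the decl below as its hypothesis `H` and yields the registered
stub `stub_fiLocusOpen`):

* base `A = k` a FIELD of characteristic `p` (a field is an excellent local ring, so the formal-fibre
  hypothesis of Theorem B holds — p.3 l.40), and `R` of finite type over `k` (⊂ essentially of finite
  type); the conclusion is openness in `Spec R` = Mathlib's `PrimeSpectrum R`, as printed;
* «Cohen–Macaulay» is spelled, for every localization `R_P` at a prime, exactly as in
  `Macaulayfication.lean`: every system of parameters of `R_P` (`d = dim R_P` elements generating an
  ideal whose radical is maximal) is a weakly regular sequence (Bruns–Herzog Thm 2.1.2 (d); such a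
  sequence lies in the maximal ideal, so weakly regular = regular, and a regular system of parameters
  forces `depth = dim`, i.e. `R_P` Cohen–Macaulay);
* under that standing Cohen–Macaulay hypothesis, «`R_P` is F-injective» is REPLACED, via Lemma 2.6
  (i)⇔(ii), by «every ideal of `R_P` generated by a system of parameters is Frobenius closed», in the
  inline form `(∃ e, y^(p^e) ∈ span {z^(p^e) | z ∈ (s)}) → y ∈ (s)` of `isFrobeniusClosed_iff` (no
  `ExpChar` instance on `R_P` needed);
* so the typed set `{P | every parameter ideal of R_P is Frobenius closed}` IS the F-injective locus of
  the Cohen–Macaulay ring `R`, and the typed conclusion is its openness in `Spec R`.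

The typed statement is therefore implied by the printed Theorem B together with the printed Lemma 2.6;
it is not stronger than print (Theorem B has NO Cohen–Macaulay hypothesis on `R` and a general local base
with good formal fibres — TODO(general form) below). Nothing is proved here; users take
`(h : DattaMurayama2024_fInjectiveLocusOpen)`.

## What is NOT here

The proof (gamma construction of Hochster–Huneke, openness for F-finite rings [Mur21], descent along the
faithfully flat CMFI map `R → R ⊗_A Â^Γ`, §5.2 pp.19–20); the general base; the non-Cohen–Macaulay case
(which would need F-injectivity via local cohomology, Def. 2.1); Lemma 2.6 as a separate decl (it is folded
into the rendering, as said above); a Cohen–Macaulay or F-injective predicate (deliberately not introduced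
— the clauses are inline, in the form the route's cruxes and `Macaulayfication.lean` use); the scheme form
for `X` locally of finite type over `k` (openness is local; done on the summit side by
`fiLocusOpen_of_ringLevel`).
-/

noncomputable section

namespace Literature.AlgebraicGeometry.Resolution

universe u

/-- NAMED FACT — **the F-injective locus of a Cohen–Macaulay algebra of finite type over a field of
characteristic `p` is open in `Spec R`** (Datta–Murayama 2024, Theorem B «Let R be a ring essentially of
finite type over a Noetherian local ring (A, 𝔪) of prime characteristic p > 0, and suppose that A has
Cohen–Macaulay and geometrically F-injective formal fibers. Then, the F-injective locus is open in
Spec(R)», arXiv v4 p.3 l.37–39 = §5.2 p.19 l.26–28, PROVED pp.19–20; special case `A = k` a field (excellent,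
p.3 l.40); F-injectivity of the Cohen–Macaulay local rings `R_P` rendered by Lemma 2.6 (i)⇔(ii) of the same
paper, p.5 l.48–53 = Quy–Shimomoto 2017 Cor. 3.9: every ideal generated by a system of parameters is
Frobenius closed). Hypotheses: `p` prime, `k` a field of characteristic `p`, `R` a `k`-algebra of finite
type, every localization `R_P` at a prime Cohen–Macaulay (every system of parameters weakly regular, as in
`KawasakiMacaulayfication`). Conclusion: the set of primes `P` such that every system of parameters `s` of
`R_P` generates an ideal `(s)` with `(∃ e, y^(p^e) ∈ span {z^(p^e) | z ∈ (s)}) → y ∈ (s)` for all `y` (i.e.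
`(s)` is Frobenius closed, `Literature.RingTheory.TightClosure.isFrobeniusClosed_iff`) is open in
`PrimeSpectrum R`.
-- TODO(general form): R essentially of finite type over a Noetherian local ring A with Cohen–Macaulay and
-- geometrically F-injective formal fibres (e.g. A excellent or a G-ring), no Cohen–Macaulay hypothesis on
-- R, F-injectivity via the Frobenius action on local cohomology (Def. 2.1).
[cite: DattaMurayama2024, Theorem B (arXiv v4 p.3; §5.2 p.19) with Lemma 2.6 (p.5)] -/
def DattaMurayama2024_fInjectiveLocusOpen : Prop :=
  ∀ (p : ℕ), p.Prime → ∀ (k : Type u) [Field k] [CharP k p] (R : Type u) [CommRing R] [Algebra k R],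
    Algebra.FiniteType k R →
    (∀ (P : Ideal R) [P.IsPrime], ∀ d : ℕ, ringKrullDim (Localization.AtPrime P) = d →
      ∀ s : Fin d → Localization.AtPrime P, (Ideal.span (Set.range s)).radical.IsMaximal →
        RingTheory.Sequence.IsWeaklyRegular (Localization.AtPrime P) (List.ofFn s)) →
    IsOpen {P : PrimeSpectrum R | ∀ d : ℕ, ringKrullDim (Localization.AtPrime P.asIdeal) = d →
      ∀ s : Fin d → Localization.AtPrime P.asIdeal, (Ideal.span (Set.range s)).radical.IsMaximal →
        ∀ y : Localization.AtPrime P.asIdeal, (∃ e : ℕ, y ^ p ^ e ∈ Ideal.span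
          ((fun z : Localization.AtPrime P.asIdeal => z ^ p ^ e) ''
            (Ideal.span (Set.range s) : Set (Localization.AtPrime P.asIdeal)))) →
          y ∈ Ideal.span (Set.range s)}

end Literature.AlgebraicGeometry.Resolution

end
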